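import Summits.BirchSwinnertonDyer.BirchSwinnertonDyer.Theorems.AdditiveKolyvaginRoadSwitchedRankLowering
import HarnessLib

/-!
# Route `AdditiveKolyvaginRoad`, crux KS′ `LevelKolyvaginSystemsAdditive` (stmt-BirchSwinnertonDyer-21396) ∕ KPA′ (stmt-BirchSwinnertonDyer-21400):
# SWITCHED CANONICAL SPACES, part 3 — the switch AT `p` and the ITERATED DESCENT: a level at which the switched spaces of both signs
# vanish, of size the switched Selmer dimension (the E-side «FL-engine» T2 of the crux card `irred-vertex-anchor`)
# (cell `pub/bsd-wall`, width seat `bsd-wall-akr-p2x-w3` g10; `--supports stmt-BirchSwinnertonDyer-21396`, helper; E-side engine; part 3 of 3,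
# sequel of `…SwitchedIso.lean` (p639624) and `…SwitchedRankLowering.lean`)

WHY. Part 2's `switched_rankLowering` is ONE step of W. Zhang's induction for the canonical spaces with E's Kummer condition above a switched set
`T` replaced by an isotropic `Λ`. The crux card `Cruxes/LevelKolyvaginSystemsAdditive/Ideas/irred-vertex-anchor.md` (T2, «FL-engine») consumes the
ITERATION at `T = {p}`: starting from level `∅`, lower one eigenspace at a time until BOTH switched eigenspaces vanish, at a level `n₀` whose size is
the switched Selmer dimension at level `∅` — so that `#n₀` is ODD exactly when that dimension is odd (the card's parity leg, E's `p`-Selmer parity +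
the even double switch at `𝔭, 𝔭̄`, is NOT done here), and at the odd vertex `n₀` the companion-side anchor (Wan ∕ Kim–Ota, preprint-grade, not in
the tree) would fire. This file gives the iteration as pure linear algebra and the engine statement at a frame.

WHAT (namespace `…Theorems.AdditiveKoly`).
* §4b **`switched_rankLowering_at_p`** — part 2's `switched_rankLowering` at `T = {p}`: every admissible `q` is coprime to `p` (`q ∤ pN`), so only
  the isotropy of `Λ` above `p` is asked.
* §5 `exists_superset_forall_eq_bot_of_step` — iteration of a one-sided rank-lowering step for a family of finite-dimensional subspaces
  `F n μ` indexed by finite levels and a sign: above every `n` there is `m ⊇ n` with `F m ± = 0` and `#m = #n + dim F n ⊤ + dim F n ⊥`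
  (induction on the total dimension; folklore).
* §6 **`exists_level_switched_eq_bot`** — THE SWITCHED LEVEL DESCENT at a frame (`p ≥ 5`, `p ∣ N_E`, `ρ̄` onto, `K` imaginary quadratic with
  the Heegner hypothesis, `c ≠ 1`; `T` finite, `0 ∉ T`, coprime to the admissible primes; `Λ` isotropic above `T`): above every level `n` a
  finite set `m ⊇ n` of Bertolini–Darmon admissible primes with `levelSelmerSubgroupP m T ± ⊓ Λ = 0` (as `𝔽_p`-spaces) and
  `#m = #n + dim(+) + dim(−)`; **`exists_level_switched_eq_bot_at_p`** — the same at `T = {p}`, level `∅`: `∃ n₀`, both switched spaces vanish at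
  `n₀` and `#n₀ = dim Sel^{{p},Λ}_∅(+) + dim Sel^{{p},Λ}_∅(−)`.

HONEST FRAMING: theorems only; 0 definitions, 0 named facts, 0 `sorry`; standard axioms; hypotheses displayed. E-side glue; closes nothing — the
parity of `#n₀`, the dictionary to a companion form (T1), the companion-side anchor (T3/T4) and exact control (T5) of the card are untouched, as is
the crux's open content. BSD is not proved by any of this.

References: [cite: WZhang2014, Prop. 5.4, Lemma 7.3, §9 (9.1)–(9.3)] [cite: BertoliniDarmon2005, Lemma 2.6, Thm. 3.2] [cite: MilneADT2006, Ch. I,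
Thm. 4.10(b)].
-/

-- single-conjunct summit: `Summit.BirchSwinnertonDyer.BirchSwinnertonDyer.…` repeats the name by design
set_option linter.dupNamespace false

noncomputable section

open scoped Classical

namespace Summit.BirchSwinnertonDyer.BirchSwinnertonDyer.Theorems.AdditiveKoly

open CategoryTheory WeierstrassCurve Field Function NumberField IsDedekindDomain
open Literature.NumberTheory.EllipticCurves Literature.NumberTheory.EllipticCurves.ModularForms
  Literature.NumberTheory.EllipticCurves.Rank1Residual Literature.NumberTheory.GaloisRepresentations Module
open Literature.NumberTheory.GaloisRepresentations.DiscreteGaloisModule (mu MuCarrier)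
open Literature.NumberTheory.GaloisCohomology
open Summit.BirchSwinnertonDyer.Rank1Residual.X11b.Three.Koly.Method2
open scoped ContRepresentation

variable (W : WeierstrassCurve ℚ) (K : Type) [Field K] [NumberField K] (p : ℕ) (c : K ≃ₐ[ℚ] K)

/-! ## §4b The switch at `p` -/

section AtP

variable [W.IsElliptic] [W.IsGloballyMinimal] [Fact p.Prime] [Module (ZMod p) (Vp W K p)]
  [∀ v : Place K, CompactSpace (absoluteGaloisGroup (Place.Completion v))]

/-- **RANK LOWERING SWITCHED AT `p`** — the case `T = {p}` of `switched_rankLowering`: E's Kummer condition at the places above `p` is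
dropped and replaced by ANY subgroup `Λ ≤ H¹(K, E[p])` whose localisations above `p` are isotropic for every Weil datum (for `p` split in the
Heegner field: e.g. the classes whose localisations at `𝔭, 𝔭̄` lie in a chosen pair of Lagrangian lines). Every admissible `q` is coprime to
`p` (`q ∤ pN`), so the switched set costs nothing. This is the «FL-engine» step T2 of the crux card `irred-vertex-anchor` in the kernel: run it
`dim` times from `n = ∅` to reach a level where the switched Selmer space vanishes. [cite: WZhang2014, Prop. 5.4, Lemma 7.3]
[cite: BertoliniDarmon2005, Lemma 2.6, Thm. 3.2] [cite: MilneADT2006, Ch. I, Thm. 4.10(b)] -/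
theorem switched_rankLowering_at_p (h5 : 5 ≤ p) (hpN : p ∣ W.conductorNorm ℤ) (hsurj : W.HasSurjectiveModNGaloisRep p)
    (hK : IsImaginaryQuadratic K) (hH : SatisfiesHeegnerHypothesis (W.conductorNorm ℤ) K) (hc1 : c ≠ 1)
    (Λ : AddSubgroup (Vp W K p))
    (hΛ : ∀ (e : geomTorsion (W.baseChange K) ((p ^ 1 : ℕ) : ℤ) → geomTorsion (W.baseChange K) ((p ^ 1 : ℕ) : ℤ) →
        AlgebraicClosure K)
      (hμ : ∀ S T, e S T ^ (p ^ 1) = 1)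
      (hadd₁ : ∀ S₁ S₂ T, e (S₁ + S₂) T = e S₁ T * e S₂ T)
      (hadd₂ : ∀ S T₁ T₂, e S (T₁ + T₂) = e S T₁ * e S T₂)
      (hgal : ∀ (σ : absoluteGaloisGroup K) (S T : geomTorsion (W.baseChange K) ((p ^ 1 : ℕ) : ℤ)),
        σ • e S T = e (σ • S) (σ • T)),
      ∀ w : HeightOneSpectrum (𝓞 K), (p : 𝓞 K) ∈ w.asIdeal → ∀ y ∈ Λ, ∀ z ∈ Λ,
        (weilContPairingLocal (W.baseChange K) (p ^ 1) e hμ hadd₁ hadd₂ hgal (Sum.inr w)).cupProduct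
          (galoisCohomology.localization ((W.baseChange K).torsionGaloisModule ((p ^ 1 : ℕ) : ℤ)) (Sum.inr w) 1 y)
          (galoisCohomology.localization ((W.baseChange K).torsionGaloisModule ((p ^ 1 : ℕ) : ℤ)) (Sum.inr w) 1 z)
          = 0) :
    ∀ (n : Finset (AdmQ W K p)) (μ : Bool) (x : Vp W K p),
      x ∈ AddSubgroup.toZModSubmodule p (levelSelmerSubgroupP W K p c (n.image Subtype.val) {p} μ ⊓ Λ) → x ≠ 0 →
      ∃ q : AdmQ W K p, q ∉ n ∧
        x ∉ AddSubgroup.toZModSubmodule p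
          (levelSelmerSubgroupP W K p c ((insert q n).image Subtype.val) {p} μ ⊓ Λ) ∧
        AddSubgroup.toZModSubmodule p (levelSelmerSubgroupP W K p c ((insert q n).image Subtype.val) {p} μ ⊓ Λ) ≤
          AddSubgroup.toZModSubmodule p (levelSelmerSubgroupP W K p c (n.image Subtype.val) {p} μ ⊓ Λ) ∧
        finrank (ZMod p)
            (AddSubgroup.toZModSubmodule p (levelSelmerSubgroupP W K p c ((insert q n).image Subtype.val) {p} μ ⊓ Λ)) + 1 =
          finrank (ZMod p) (AddSubgroup.toZModSubmodule p (levelSelmerSubgroupP W K p c (n.image Subtype.val) {p} μ ⊓ Λ)) ∧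
        AddSubgroup.toZModSubmodule p (levelSelmerSubgroupP W K p c ((insert q n).image Subtype.val) {p} (!μ) ⊓ Λ) =
          AddSubgroup.toZModSubmodule p (levelSelmerSubgroupP W K p c (n.image Subtype.val) {p} (!μ) ⊓ Λ) := by
  have hp : p.Prime := Fact.out
  refine switched_rankLowering W K p c h5 hpN hsurj hK hH hc1 {p} (Set.finite_singleton p) ?_ Λ ?_
  · -- every admissible prime is coprime to `p`
    intro t ht q
    rw [Set.mem_singleton_iff] at ht
    subst ht
    obtain ⟨hqprime, hqpN, -, -, -⟩ := q.2
    refine (Nat.coprime_primes hqprime hp).mpr fun h ↦ hqpN ?_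
    rw [h]
    exact dvd_mul_right _ _
  · intro e hμ hadd₁ hadd₂ hgal t ht w htw
    rw [Set.mem_singleton_iff] at ht
    subst ht
    exact hΛ e hμ hadd₁ hadd₂ hgal w htw


end AtP

/-! ## §5 Iterating a rank-lowering step: a level above `n` where both eigenspaces vanish, of controlled size (linear algebra) -/

section Iterate

/-- **Iteration of a one-sided rank-lowering step** (pure linear algebra; the shape of W. Zhang's induction §9 as used by the «FL-engine»):
let `F n μ` be finite-dimensional subspaces indexed by finite levels `n` and a sign `μ`, such that every non-zero vector of `F n μ` is killed
by enlarging the level by one element `q ∉ n`, the `μ`-side dropping by EXACTLY one dimension and the `¬μ`-side staying put. Then above every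
level `n` there is a level `m ⊇ n` at which BOTH sides vanish, with `#m = #n + dim F n ⊤ + dim F n ⊥`. Proof: induction on the total
dimension. [folklore] -/
theorem exists_superset_forall_eq_bot_of_step {α : Type*} [DecidableEq α] {k V : Type*} [Field k] [AddCommGroup V]
    [Module k V] (F : Finset α → Bool → Submodule k V) [hfin : ∀ n μ, FiniteDimensional k (F n μ)]
    (step : ∀ (n : Finset α) (μ : Bool) (x : V), x ∈ F n μ → x ≠ 0 →
      ∃ q : α, q ∉ n ∧ finrank k (F (insert q n) μ) + 1 = finrank k (F n μ) ∧ F (insert q n) (!μ) = F n (!μ))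
    (n : Finset α) :
    ∃ m : Finset α, n ⊆ m ∧ (∀ μ, F m μ = ⊥) ∧ m.card = n.card + finrank k (F n true) + finrank k (F n false) := by
  -- induction on the total dimension `d`
  suffices h : ∀ (d : ℕ) (n : Finset α), finrank k (F n true) + finrank k (F n false) = d →
      ∃ m : Finset α, n ⊆ m ∧ (∀ μ, F m μ = ⊥) ∧ m.card = n.card + finrank k (F n true) + finrank k (F n false) from
    h _ n rfl
  intro d
  induction d with
  | zero =>
    intro n hd
    have ht : finrank k (F n true) = 0 := by omega
    have hf : finrank k (F n false) = 0 := by omega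
    refine ⟨n, le_rfl, fun μ ↦ ?_, by rw [ht, hf]; rfl⟩
    cases μ
    · exact Submodule.finrank_eq_zero.mp hf
    · exact Submodule.finrank_eq_zero.mp ht
  | succ d ih =>
    intro n hd
    -- one side is non-zero; pick a non-zero vector there and lower
    have hex : ∃ μ, finrank k (F n μ) ≠ 0 := by
      by_contra h
      push Not at h
      have := h true
      have := h false
      omega
    obtain ⟨μ, hμ⟩ := hex
    have hne : F n μ ≠ ⊥ := fun h ↦ hμ (by rw [h, finrank_bot])
    obtain ⟨x, hx, hx0⟩ := (Submodule.ne_bot_iff _).mp hne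
    obtain ⟨q, hqn, hdim, hother⟩ := step n μ x hx hx0
    have hd' : finrank k (F (insert q n) true) + finrank k (F (insert q n) false) = d := by
      cases μ
      · simp only [Bool.not_false] at hother
        rw [hother]
        omega
      · simp only [Bool.not_true] at hother
        rw [hother]
        omega
    obtain ⟨m, hnm, hm, hcard⟩ := ih (insert q n) hd'
    refine ⟨m, (Finset.subset_insert q n).trans hnm, hm, ?_⟩
    rw [hcard, Finset.card_insert_of_notMem hqn]
    cases μ
    · simp only [Bool.not_false] at hother
      rw [hother]
      omega
    · simp only [Bool.not_true] at hother
      rw [hother]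
      omega

end Iterate

/-! ## §6 The «FL-engine» at a frame: a level where the switched spaces of both signs vanish, of size the switched Selmer dimension -/

section Engine

variable [W.IsElliptic] [W.IsGloballyMinimal] [Fact p.Prime] [Module (ZMod p) (Vp W K p)]
  [∀ v : Place K, CompactSpace (absoluteGaloisGroup (Place.Completion v))]

/-- **THE SWITCHED LEVEL DESCENT** (the E-side «FL-engine» T2 of the crux card `irred-vertex-anchor`, generic in the switched condition): at a
frame as in `switched_rankLowering` and for `T`, `Λ` as there, above every level `n` there is a finite set `m ⊇ n` of Bertolini–Darmon admissible
primes at which the switched canonical spaces of BOTH signs VANISH, with `#m = #n + dim Sel^{T,Λ}_n(+) + dim Sel^{T,Λ}_n(−)`. In particular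
(`n = ∅`) there is a level `n₀` with `Sel^{T,Λ}_{n₀}(±) = 0` and `#n₀ = dim Sel^{T,Λ}_∅(+) + dim Sel^{T,Λ}_∅(−)` — so `#n₀` is ODD exactly when
the switched Selmer dimension at level `∅` is odd (the card's parity leg: E's `p`-Selmer parity + the even double switch at `𝔭, 𝔭̄`, not done
here). `switched_rankLowering` iterated (`exists_superset_forall_eq_bot_of_step`); finite-dimensionality from `finite_levelSelmerSubgroupP`.
[cite: WZhang2014, Prop. 5.4, Lemma 7.3, §9] [cite: BertoliniDarmon2005, Thm. 3.2] -/
theorem exists_level_switched_eq_bot (h5 : 5 ≤ p) (hpN : p ∣ W.conductorNorm ℤ) (hsurj : W.HasSurjectiveModNGaloisRep p)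
    (hK : IsImaginaryQuadratic K) (hH : SatisfiesHeegnerHypothesis (W.conductorNorm ℤ) K) (hc1 : c ≠ 1)
    (T : Set ℕ) (hTfin : T.Finite) (hT0 : (0 : ℕ) ∉ T) (hT : ∀ t ∈ T, ∀ q : AdmQ W K p, Nat.Coprime (q : ℕ) t)
    (Λ : AddSubgroup (Vp W K p))
    (hΛ : ∀ (e : geomTorsion (W.baseChange K) ((p ^ 1 : ℕ) : ℤ) → geomTorsion (W.baseChange K) ((p ^ 1 : ℕ) : ℤ) →
        AlgebraicClosure K)
      (hμ : ∀ S T, e S T ^ (p ^ 1) = 1)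
      (hadd₁ : ∀ S₁ S₂ T, e (S₁ + S₂) T = e S₁ T * e S₂ T)
      (hadd₂ : ∀ S T₁ T₂, e S (T₁ + T₂) = e S T₁ * e S T₂)
      (hgal : ∀ (σ : absoluteGaloisGroup K) (S T : geomTorsion (W.baseChange K) ((p ^ 1 : ℕ) : ℤ)),
        σ • e S T = e (σ • S) (σ • T)),
      ∀ t ∈ T, ∀ w : HeightOneSpectrum (𝓞 K), (t : 𝓞 K) ∈ w.asIdeal → ∀ y ∈ Λ, ∀ z ∈ Λ,
        (weilContPairingLocal (W.baseChange K) (p ^ 1) e hμ hadd₁ hadd₂ hgal (Sum.inr w)).cupProduct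
          (galoisCohomology.localization ((W.baseChange K).torsionGaloisModule ((p ^ 1 : ℕ) : ℤ)) (Sum.inr w) 1 y)
          (galoisCohomology.localization ((W.baseChange K).torsionGaloisModule ((p ^ 1 : ℕ) : ℤ)) (Sum.inr w) 1 z)
          = 0)
    (n : Finset (AdmQ W K p)) :
    ∃ m : Finset (AdmQ W K p), n ⊆ m ∧
      (∀ μ, AddSubgroup.toZModSubmodule p (levelSelmerSubgroupP W K p c (m.image Subtype.val) T μ ⊓ Λ) = ⊥) ∧
      m.card = n.card +
        finrank (ZMod p) (AddSubgroup.toZModSubmodule p (levelSelmerSubgroupP W K p c (n.image Subtype.val) T true ⊓ Λ)) +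
        finrank (ZMod p) (AddSubgroup.toZModSubmodule p (levelSelmerSubgroupP W K p c (n.image Subtype.val) T false ⊓ Λ)) := by
  -- the family of switched spaces and its finite-dimensionality
  set F : Finset (AdmQ W K p) → Bool → Submodule (ZMod p) (Vp W K p) := fun n μ ↦
    AddSubgroup.toZModSubmodule p (levelSelmerSubgroupP W K p c (n.image Subtype.val) T μ ⊓ Λ) with hF
  haveI hfin : ∀ (m : Finset (AdmQ W K p)) (μ : Bool), FiniteDimensional (ZMod p) (F m μ) := by
    intro m μ
    have h1 : Finite (levelSelmerSubgroupP W K p c (m.image Subtype.val) T μ) := by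
      refine finite_levelSelmerSubgroupP W K p c _ _ hTfin ?_ μ
      rintro (h | h)
      · rw [Finset.mem_coe, Finset.mem_image] at h
        obtain ⟨q', -, hq'⟩ := h
        exact AdmQ.ne_zero W K p q' hq'
      · exact hT0 h
    have h2 : Finite (levelSelmerSubgroupP W K p c (m.image Subtype.val) T μ ⊓ Λ : AddSubgroup (Vp W K p)) :=
      Finite.of_injective (fun y ↦ (⟨y.1, (AddSubgroup.mem_inf.mp y.2).1⟩ :
          levelSelmerSubgroupP W K p c (m.image Subtype.val) T μ))
        (fun y y' h ↦ Subtype.ext (by simpa using congrArg Subtype.val h))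
    have h3 : Finite (F m μ) :=
      Finite.of_equiv _ (Equiv.setCongr (AddSubgroup.coe_toZModSubmodule p _).symm)
    exact Module.Finite.of_finite
  have hstep := switched_rankLowering W K p c h5 hpN hsurj hK hH hc1 T hTfin hT Λ hΛ
  obtain ⟨m, hnm, hm, hcard⟩ := exists_superset_forall_eq_bot_of_step F (fun n μ x hx hx0 ↦ by
    obtain ⟨q, hqn, -, -, hdim, hother⟩ := hstep n μ x hx hx0
    exact ⟨q, hqn, hdim, hother⟩) n
  exact ⟨m, hnm, hm, hcard⟩

end Engine

/-! ## §7 The engine at `T = {p}`, level `∅` -/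

section EngineAtP

variable [W.IsElliptic] [W.IsGloballyMinimal] [Fact p.Prime] [Module (ZMod p) (Vp W K p)]
  [∀ v : Place K, CompactSpace (absoluteGaloisGroup (Place.Completion v))]

/-- **THE «FL-ENGINE» AT `p` (T2 of the crux card `irred-vertex-anchor`, E-side, unconditionally):** at a frame (`p ≥ 5`, `p ∣ N_E`,
`ρ̄_{E,p}` onto, `K` imaginary quadratic with the Heegner hypothesis for `N_E`, complex conjugation `c ≠ 1`) and for ANY subgroup
`Λ ≤ H¹(K, E[p])` whose localisations above `p` are isotropic for every Weil datum (e.g. the classes landing in a chosen pair of Lagrangian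
lines at `𝔭, 𝔭̄`), there is a finite set `n₀` of Bertolini–Darmon admissible primes at which the SWITCHED canonical spaces of both signs — E's
Kummer condition off `n₀ ∪ {places above p}`, toric at `n₀`, `Λ` instead of E's condition above `p` — VANISH, and
`#n₀ = dim_{𝔽_p} Sel^{{p},Λ}_∅(+) + dim_{𝔽_p} Sel^{{p},Λ}_∅(−)`. [cite: WZhang2014, Prop. 5.4, Lemma 7.3, §9] [cite: BertoliniDarmon2005, Thm. 3.2] -/
theorem exists_level_switched_eq_bot_at_p (h5 : 5 ≤ p) (hpN : p ∣ W.conductorNorm ℤ) (hsurj : W.HasSurjectiveModNGaloisRep p)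
    (hK : IsImaginaryQuadratic K) (hH : SatisfiesHeegnerHypothesis (W.conductorNorm ℤ) K) (hc1 : c ≠ 1)
    (Λ : AddSubgroup (Vp W K p))
    (hΛ : ∀ (e : geomTorsion (W.baseChange K) ((p ^ 1 : ℕ) : ℤ) → geomTorsion (W.baseChange K) ((p ^ 1 : ℕ) : ℤ) →
        AlgebraicClosure K)
      (hμ : ∀ S T, e S T ^ (p ^ 1) = 1)
      (hadd₁ : ∀ S₁ S₂ T, e (S₁ + S₂) T = e S₁ T * e S₂ T)
      (hadd₂ : ∀ S T₁ T₂, e S (T₁ + T₂) = e S T₁ * e S T₂)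
      (hgal : ∀ (σ : absoluteGaloisGroup K) (S T : geomTorsion (W.baseChange K) ((p ^ 1 : ℕ) : ℤ)),
        σ • e S T = e (σ • S) (σ • T)),
      ∀ w : HeightOneSpectrum (𝓞 K), (p : 𝓞 K) ∈ w.asIdeal → ∀ y ∈ Λ, ∀ z ∈ Λ,
        (weilContPairingLocal (W.baseChange K) (p ^ 1) e hμ hadd₁ hadd₂ hgal (Sum.inr w)).cupProduct
          (galoisCohomology.localization ((W.baseChange K).torsionGaloisModule ((p ^ 1 : ℕ) : ℤ)) (Sum.inr w) 1 y)
          (galoisCohomology.localization ((W.baseChange K).torsionGaloisModule ((p ^ 1 : ℕ) : ℤ)) (Sum.inr w) 1 z)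
          = 0) :
    ∃ n₀ : Finset (AdmQ W K p),
      (∀ μ, AddSubgroup.toZModSubmodule p (levelSelmerSubgroupP W K p c (n₀.image Subtype.val) {p} μ ⊓ Λ) = ⊥) ∧
      n₀.card =
        finrank (ZMod p) (AddSubgroup.toZModSubmodule p (levelSelmerSubgroupP W K p c ∅ {p} true ⊓ Λ)) +
        finrank (ZMod p) (AddSubgroup.toZModSubmodule p (levelSelmerSubgroupP W K p c ∅ {p} false ⊓ Λ)) := by
  have hp : p.Prime := Fact.out
  have hT : ∀ t ∈ ({p} : Set ℕ), ∀ q : AdmQ W K p, Nat.Coprime (q : ℕ) t := by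
    intro t ht q
    rw [Set.mem_singleton_iff] at ht
    subst ht
    obtain ⟨hqprime, hqpN, -, -, -⟩ := q.2
    refine (Nat.coprime_primes hqprime hp).mpr fun h ↦ hqpN ?_
    rw [h]
    exact dvd_mul_right _ _
  have hΛ' : ∀ (e : geomTorsion (W.baseChange K) ((p ^ 1 : ℕ) : ℤ) → geomTorsion (W.baseChange K) ((p ^ 1 : ℕ) : ℤ) →
        AlgebraicClosure K)
      (hμ : ∀ S T, e S T ^ (p ^ 1) = 1)
      (hadd₁ : ∀ S₁ S₂ T, e (S₁ + S₂) T = e S₁ T * e S₂ T)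
      (hadd₂ : ∀ S T₁ T₂, e S (T₁ + T₂) = e S T₁ * e S T₂)
      (hgal : ∀ (σ : absoluteGaloisGroup K) (S T : geomTorsion (W.baseChange K) ((p ^ 1 : ℕ) : ℤ)),
        σ • e S T = e (σ • S) (σ • T)),
      ∀ t ∈ ({p} : Set ℕ), ∀ w : HeightOneSpectrum (𝓞 K), (t : 𝓞 K) ∈ w.asIdeal → ∀ y ∈ Λ, ∀ z ∈ Λ,
        (weilContPairingLocal (W.baseChange K) (p ^ 1) e hμ hadd₁ hadd₂ hgal (Sum.inr w)).cupProduct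
          (galoisCohomology.localization ((W.baseChange K).torsionGaloisModule ((p ^ 1 : ℕ) : ℤ)) (Sum.inr w) 1 y)
          (galoisCohomology.localization ((W.baseChange K).torsionGaloisModule ((p ^ 1 : ℕ) : ℤ)) (Sum.inr w) 1 z)
          = 0 := by
    intro e hμ hadd₁ hadd₂ hgal t ht w htw
    rw [Set.mem_singleton_iff] at ht
    subst ht
    exact hΛ e hμ hadd₁ hadd₂ hgal w htw
  obtain ⟨m, -, hm, hcard⟩ := exists_level_switched_eq_bot W K p c h5 hpN hsurj hK hH hc1 {p} (Set.finite_singleton p)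
    (by rw [Set.mem_singleton_iff]; exact hp.ne_zero.symm) hT Λ hΛ' ∅
  refine ⟨m, hm, ?_⟩
  rw [hcard, Finset.card_empty, zero_add, Finset.image_empty]

end EngineAtP

end Summit.BirchSwinnertonDyer.BirchSwinnertonDyer.Theorems.AdditiveKoly

end
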